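import Summits.HodgeConjecture.HodgeConjecture.Theses.OG6CharacterSectors
import Summits.HodgeConjecture.HodgeConjecture.Theorems.OG6CharacterSectorsFourierInversion
import Literature.AlgebraicGeometry.HodgeTheory.AlgebraicClassesPullbackDimLEThree
import Literature.AlgebraicGeometry.HodgeTheory.HypersurfaceLefschetz

/-!
# Route `OG6CharacterSectors` — support items `OuterDegrees` (stmt-HodgeConjecture-9357) and
# `OddCharactersOffMiddle` (stmt-HodgeConjecture-9359)

For an OG6 frame `(X, g)` — `X` smooth projective of dimension `6`, `g : (ℤ/2)⁸ → Aut X` a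
homomorphism acting trivially on `H²(X(ℂ); ℂ)` — and a character `a ≠ 0` with projector
`e_a = (1/256) Σ_b (-1)^{a·b} g_b^*`:

* `OuterDegrees`: for `p ∉ {2, 3, 4}` the `e_a`-component of a rational `(p,p)`-class in `H^{2p}` is
  algebraic.  Degrees `p = 0` and `p ≥ 6` are entirely algebraic (the tree's
  `algebraicClasses_eq_top_of_eq_zero_or_le`: `H⁰`, the top degree, and zero groups above it); on
  `H²` the group acts trivially, so `e_a = (1/256)(Σ_b (-1)^{a·b})·id = 0` for `a ≠ 0` (character
  orthogonality); on `H¹⁰` the group acts trivially as well, by HARD LEFSCHETZ `L⁴ : H² ≅ H¹⁰`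
  (tree theorem `nonempty_hardLefschetzNFold_holds`, Voisin I Thm. 6.25) and naturality of `L` under
  pull-backs fixing the hyperplane class (`map_lefschetzPowTo`).
* `OddCharactersOffMiddle`: if `e_a` kills `H⁴` then it kills `H⁸`, since `L² : H⁴ ≅ H⁸` (hard
  Lefschetz) commutes with every `g_b^*` (the hyperplane class lies in the `G`-trivial `H²`), hence
  with `e_a`.

In all cases the projected class is `0` or lies in a degree where every class is algebraic; no case
of the Hodge conjecture is claimed.  No definition, no named-fact hypothesis, no sorry.
-/

set_option linter.dupNamespace false

noncomputable section

namespace Summit.HodgeConjecture.HodgeConjecture.Theorems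

open scoped BigOperators
open CategoryTheory Literature.AlgebraicGeometry.HodgeTheory Literature.AlgebraicGeometry.Motives

/-- Character orthogonality, summed over the second variable: `Σ_b (-1)^{a·b} = 256·[a = 0]`. -/
theorem og6_charSum' (a : Fin 8 → ZMod 2) :
    ∑ b : Fin 8 → ZMod 2, (-1 : ℂ) ^ (∑ i : Fin 8, (a i * b i).val) =
      if a = 0 then 256 else 0 := by
  simp_rw [mul_comm (a _)]
  exact og6_charSum a

/-- If every `g_b^*` fixes `c`, then `e_a c = 0` for `a ≠ 0`. -/
theorem og6_projector_eq_zero_of_fixed {X : SchemeOver ℂ} (g : (Fin 8 → ZMod 2) → (X ⟶ X)) {k : ℕ}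
    {a : Fin 8 → ZMod 2} (ha : a ≠ 0) (c : complexBetti X k)
    (hfix : ∀ b, complexBetti.map (g b) k c = c) :
    ((1 / 256 : ℂ) • ∑ b : (Fin 8 → ZMod 2),
      ((-1 : ℂ) ^ (∑ i : Fin 8, (a i * b i).val)) • complexBetti.map (g b) k c) = 0 := by
  simp_rw [hfix]
  rw [← Finset.sum_smul, og6_charSum', if_neg ha, zero_smul, smul_zero]

/-- On a smooth projective `6`-fold, automorphisms acting trivially on `H²` act trivially on `H¹⁰`
(hard Lefschetz `L⁴ : H² ≅ H¹⁰` and naturality of `L`). [cite: VoisinHodgeI2002, Thm. 6.25] -/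
theorem og6_map_ten_eq_self {X : SchemeOver ℂ} (hX : IsSmoothProjective 6 X)
    (g : (Fin 8 → ZMod 2) → (X ⟶ X))
    (hG2 : ∀ (a : Fin 8 → ZMod 2) (x : complexBetti X 2), complexBetti.map (g a) 2 x = x)
    (b : Fin 8 → ZMod 2) (c : complexBetti X 10) : complexBetti.map (g b) 10 c = c := by
  obtain ⟨Λ⟩ := nonempty_hardLefschetzNFold_holds 6 X hX
  obtain ⟨c', rfl⟩ := (Λ.bijective_L (j := 4) (k := 2) (by norm_num) 10 (by norm_num)).2 c
  rw [HardLefschetzNFold.L, map_lefschetzPowTo, hG2, hG2]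

/-- On a smooth projective `6`-fold with automorphisms acting trivially on `H²`: if the projector
`e_a` kills `H⁴` it kills `H⁸` (`L² : H⁴ ≅ H⁸` commutes with `e_a`). [cite: VoisinHodgeI2002, Thm. 6.25] -/
theorem og6_projector_eight_eq_zero {X : SchemeOver ℂ} (hX : IsSmoothProjective 6 X)
    (g : (Fin 8 → ZMod 2) → (X ⟶ X))
    (hG2 : ∀ (a : Fin 8 → ZMod 2) (x : complexBetti X 2), complexBetti.map (g a) 2 x = x)
    {a : Fin 8 → ZMod 2}
    (hodd : ∀ x : complexBetti X 4, ((1 / 256 : ℂ) • ∑ b : (Fin 8 → ZMod 2),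
      ((-1 : ℂ) ^ (∑ i : Fin 8, (a i * b i).val)) • complexBetti.map (g b) 4 x) = 0)
    (c : complexBetti X 8) :
    ((1 / 256 : ℂ) • ∑ b : (Fin 8 → ZMod 2),
      ((-1 : ℂ) ^ (∑ i : Fin 8, (a i * b i).val)) • complexBetti.map (g b) 8 c) = 0 := by
  obtain ⟨Λ⟩ := nonempty_hardLefschetzNFold_holds 6 X hX
  have h8 : 4 + 2 * 2 = 8 := by norm_num
  obtain ⟨x, rfl⟩ := (Λ.bijective_L (j := 2) (k := 4) (by norm_num) 8 h8).2 c
  have hnat : ∀ b, complexBetti.map (g b) 8 (Λ.L 2 4 8 h8 x) =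
      Λ.L 2 4 8 h8 (complexBetti.map (g b) 4 x) := fun b => by
    rw [HardLefschetzNFold.L, map_lefschetzPowTo, hG2]
  have key : Λ.L 2 4 8 h8 ((1 / 256 : ℂ) • ∑ b : (Fin 8 → ZMod 2),
        ((-1 : ℂ) ^ (∑ i : Fin 8, (a i * b i).val)) • complexBetti.map (g b) 4 x) =
      (1 / 256 : ℂ) • ∑ b : (Fin 8 → ZMod 2),
        ((-1 : ℂ) ^ (∑ i : Fin 8, (a i * b i).val)) • complexBetti.map (g b) 8 (Λ.L 2 4 8 h8 x) := by
    rw [LinearMap.map_smul, map_sum]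
    simp_rw [LinearMap.map_smul, hnat]
  rw [← key, hodd x, map_zero]

/-- **Item stmt-HodgeConjecture-9357 (`OuterDegrees`, route `OG6CharacterSectors`)**: for an OG6 frame,
`p ∉ {2,3,4}`, `a ≠ 0`, the `e_a`-component of a rational `(p,p)`-class in `H^{2p}` is algebraic —
`H⁰` and the degrees `≥ 12` are entirely algebraic (`algebraicClasses_eq_top_of_eq_zero_or_le`), and on
`H²` (trivial action, by hypothesis) and `H¹⁰` (trivial action, by hard Lefschetz `L⁴ : H² ≅ H¹⁰`)
the projector `e_a`, `a ≠ 0`, vanishes by character orthogonality.  The type is literally the route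
decl `Summit.HodgeConjecture.HodgeConjecture.Theses.OG6CharacterSectors.OuterDegrees`.
[cite: VoisinHodgeI2002, Thm. 6.25 and §11.1.2] [cite: Floccari2023, §1] -/
theorem og6CharacterSectors_outerDegrees_proof :
    Summit.HodgeConjecture.HodgeConjecture.Theses.OG6CharacterSectors.OuterDegrees := by
  unfold Summit.HodgeConjecture.HodgeConjecture.Theses.OG6CharacterSectors.OuterDegrees
  intro X g hFr p hp2 hp3 hp4 a ha c _ _
  obtain ⟨hX, -, -, -, -, -, -, -, hG2⟩ := hFr
  by_cases hp : p = 0 ∨ 6 ≤ p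
  · rw [algebraicClasses_eq_top_of_eq_zero_or_le hX hp]
    exact Submodule.mem_top
  · have hp15 : p = 1 ∨ p = 5 := by omega
    rcases hp15 with rfl | rfl
    · have hfix : ∀ b, complexBetti.map (g b) (2 * 1) c = c := fun b => hG2 b c
      rw [og6_projector_eq_zero_of_fixed g ha c hfix]
      exact Submodule.zero_mem _
    · have hfix : ∀ b, complexBetti.map (g b) (2 * 5) c = c := fun b =>
        og6_map_ten_eq_self hX g hG2 b c
      rw [og6_projector_eq_zero_of_fixed g ha c hfix]
      exact Submodule.zero_mem _

/-- **Item stmt-HodgeConjecture-9359 (`OddCharactersOffMiddle`, route `OG6CharacterSectors`)**: for an OG6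
frame and a character `a ≠ 0` whose projector `e_a` kills `H⁴`, `e_a` of a rational `(4,4)`-class in
`H⁸` is algebraic — indeed zero: `L² : H⁴ ≅ H⁸` (hard Lefschetz) commutes with every `g_b^*` (the
hyperplane class is `G`-fixed), hence `e_a ∘ L² = L² ∘ e_a = 0`.  The type is literally the route
decl `Summit.HodgeConjecture.HodgeConjecture.Theses.OG6CharacterSectors.OddCharactersOffMiddle`.
[cite: VoisinHodgeI2002, Thm. 6.25] [cite: Floccari2023, §1] -/
theorem og6CharacterSectors_oddCharactersOffMiddle_proof :
    Summit.HodgeConjecture.HodgeConjecture.Theses.OG6CharacterSectors.OddCharactersOffMiddle := by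
  unfold Summit.HodgeConjecture.HodgeConjecture.Theses.OG6CharacterSectors.OddCharactersOffMiddle
  intro X g hFr a ha hodd c _ _
  obtain ⟨hX, -, -, -, -, -, -, -, hG2⟩ := hFr
  have hodd' : ∀ x : complexBetti X 4, ((1 / 256 : ℂ) • ∑ b : (Fin 8 → ZMod 2),
      ((-1 : ℂ) ^ (∑ i : Fin 8, (a i * b i).val)) • complexBetti.map (g b) 4 x) = 0 := hodd
  have h : ((1 / 256 : ℂ) • ∑ b : (Fin 8 → ZMod 2),
      ((-1 : ℂ) ^ (∑ i : Fin 8, (a i * b i).val)) • complexBetti.map (g b) (2 * 4) c) = 0 :=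
    og6_projector_eight_eq_zero hX g hG2 hodd' c
  rw [h]
  exact Submodule.zero_mem _

end Summit.HodgeConjecture.HodgeConjecture.Theorems

end
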